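import Mathlib.Algebra.Field.ZMod
import Mathlib.Data.Matrix.Mul
import Mathlib.Algebra.BigOperators.Ring.Finset
import Mathlib.Algebra.BigOperators.Pi
import Mathlib.Algebra.Order.BigOperators.Group.Finset
import Mathlib.Data.Real.Basic
import Mathlib.Tactic.Positivity
import Mathlib.Tactic.FieldSimp
import Mathlib.Tactic.Linarith
import Mathlib.Tactic.GCongr
import Mathlib.Tactic.Ring
import Mathlib.Tactic.Abel
import HarnessLib

/-!
# Goldreich–Levin over `𝔽_p`: local list decoding of the `p`-ary Hadamard code (combinatorial core)

Groundwork for the named fact `Literature.Computability.Learning.cikk_learn_AC0Mod` (CIKK 2016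
Cor. 5.4), odd primes: the mathematical content of CIKK Thm. 4.2 — "given oracle access to
`B : Fᵏ → F` with `Pr_r[B(r) = ⟨h, r⟩] ≥ 1/p + γ` one computes in time `poly(k, 1/γ)` a list of
size `poly` containing `h` with probability `≥ 1/2`" (Goldreich–Levin 1989 for `p = 2`,
Goldreich–Rubinfeld–Sudan 2000 for all primes) — in an exact counting form, by RACKOFF'S METHOD
(pairwise independent combined queries from `kk` random seeds, all `p^kk` guesses of the values
`⟨x, sᵗ⟩`; Arora–Barak Thm. 9.12) adapted to agreement `1/p + γ` through HISTOGRAM ALIGNMENT: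
with the correct guess, the histogram of the votes `B(r_c + eᵢ) - ⟨σ, c⟩` over the queries `c`
is a shift by `xᵢ` of the noise histogram `B(r_c) - ⟨σ, c⟩`, and the shift is unique because a
distribution on `𝔽_p` with an atom of mass `> 1/p` is not (approximately) periodic.

This first file sets up the queries and proves their uniformity and PAIRWISE INDEPENDENCE:

* `FVec p n`, the canonical query coefficients `reps p kk` (vectors `c ∈ 𝔽_p^{kk}` whose first
  nonzero entry is `1`; `card_reps_ge`: at least `p^{kk-1}` of them), the combined query
  `seedComb s c = Σ_t c_t • sᵗ`;
* `card_fibre_seedComb` (`#{s : r_c(s) = v} = |Ω|/|V|`) and `card_fibre_seedComb_pair`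
  (`#{s : r_c(s) = v, r_{c'}(s) = v'} = |Ω|/|V|²` for distinct `c, c' ∈ reps`), via explicit
  preimages on two coordinates and translation.

All statements are proved; no named facts.

## References

* O. Goldreich, R. Rubinfeld, M. Sudan, *Learning polynomials with queries: the highly noisy
  case*, SIAM J. Discrete Math. 13 (2000) (the `GF(p)` statement).
* S. Arora, B. Barak, *Computational Complexity: A Modern Approach*, CUP 2009, Thm. 9.12 (proof:
  Rackoff's pairwise independent queries) [AroraBarak2009].
* M. Carmosino, R. Impagliazzo, V. Kabanets, A. Kolokolova, *Learning algorithms from natural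
  proofs*, CCC 2016, Thm. 4.2 [CarmosinoImpagliazzoKabanetsKolokolova2016].
-/

namespace Literature.Computability.Cryptography

open Finset Matrix

/-- Vectors of length `n` over `𝔽_p`. [folklore] -/
abbrev FVec (p n : ℕ) : Type := Fin n → ZMod p

variable {p : ℕ} {n kk : ℕ}

/-! ### Rackoff's queries over `𝔽_p` -/

/-- The combined query `r_c(s) = Σ_t c_t • sᵗ` of a seed tuple and a coefficient vector. [cite: AroraBarak2009, Thm. 9.12 (proof, "`r^j = Σ_{t ∈ T_j} s^t`")] -/
def seedComb (s : Fin kk → FVec p n) (c : Fin kk → ZMod p) : FVec p n := ∑ t, c t • s t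

/-- **The canonical query coefficients**: vectors `c` with a position `t` such that `c` vanishes
before `t` and `c t = 1` (one representative of each line of `𝔽_p^{kk}`, so that two distinct
representatives are linearly independent). [folklore] -/
def IsRep (c : Fin kk → ZMod p) : Prop := ∃ t : Fin kk, (∀ t' : Fin kk, t' < t → c t' = 0) ∧ c t = 1

/-- Decidability of being a representative. [folklore] -/
instance (c : Fin kk → ZMod p) : Decidable (IsRep c) := by unfold IsRep; infer_instance

/-! ### Linear algebra of the queries -/

/-- `seedComb` is additive in the seed tuple. [folklore] -/
theorem seedComb_add (s s' : Fin kk → FVec p n) (c : Fin kk → ZMod p) :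
    seedComb (s + s') c = seedComb s c + seedComb s' c := by
  simp [seedComb, smul_add, Finset.sum_add_distrib]

/-- `seedComb` is subtractive in the seed tuple. [folklore] -/
theorem seedComb_sub (s s' : Fin kk → FVec p n) (c : Fin kk → ZMod p) :
    seedComb (s - s') c = seedComb s c - seedComb s' c := by
  simp [seedComb, smul_sub, Finset.sum_sub_distrib]

/-- `seedComb` of a seed tuple supported on one coordinate. [folklore] -/
theorem seedComb_single (t₀ : Fin kk) (v : FVec p n) (c : Fin kk → ZMod p) :
    seedComb (Pi.single t₀ v : Fin kk → FVec p n) c = c t₀ • v := by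
  classical
  rw [seedComb, Finset.sum_eq_single t₀]
  · rw [Pi.single_eq_same]
  · intro t _ ht; rw [Pi.single_eq_of_ne ht, smul_zero]
  · intro h; exact absurd (mem_univ t₀) h

/-- The inner product with a combined query is the combination of the inner products. [folklore] -/
theorem dotProduct_seedComb (x : FVec p n) (s : Fin kk → FVec p n) (c : Fin kk → ZMod p) :
    x ⬝ᵥ seedComb s c = ∑ t, c t * (x ⬝ᵥ s t) := by
  simp [seedComb, dotProduct_sum, dotProduct_smul]

variable [hp : Fact p.Prime]

/-- The finset of representatives. [folklore] -/
def reps (p kk : ℕ) [Fact p.Prime] : Finset (Fin kk → ZMod p) := univ.filter fun c => IsRep c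

/-- Membership in `reps`. [folklore] -/
theorem mem_reps {c : Fin kk → ZMod p} : c ∈ reps p kk ↔ IsRep c := by simp [reps]

/-- **There are at least `p^{kk-1}` representatives** (those with `c 0 = 1`), for `kk ≥ 1`. [folklore] -/
theorem card_reps_ge (hk : 0 < kk) : p ^ (kk - 1) ≤ (reps p kk).card := by
  classical
  obtain ⟨k, rfl⟩ : ∃ k, kk = k + 1 := ⟨kk - 1, by omega⟩
  rw [Nat.add_sub_cancel]
  -- the injection `d ↦ cons 1 d`
  have hinj : Function.Injective (fun d : Fin k → ZMod p => (Fin.cons 1 d : Fin (k + 1) → ZMod p)) :=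
    fun d d' h => by simpa using congrArg Fin.tail h
  calc p ^ k = (univ : Finset (Fin k → ZMod p)).card := by simp
    _ = ((univ : Finset (Fin k → ZMod p)).map ⟨_, hinj⟩).card := (card_map _).symm
    _ ≤ (reps p (k + 1)).card := card_le_card fun c hc => by
        obtain ⟨d, -, rfl⟩ := mem_map.1 hc
        exact mem_reps.2 ⟨0, fun t' ht' => absurd ht' (Nat.not_lt_zero _), by simp⟩

/-! ### Uniformity and pairwise independence of the queries -/

section Fibres

/-- All fibres of `s ↦ r_c(s)` (`c` a representative) have the size of the zero fibre. [folklore] -/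
theorem card_fibre_seedComb_eq {c : Fin kk → ZMod p} (hc : IsRep c) (v : FVec p n) :
    (univ.filter fun s : Fin kk → FVec p n => seedComb s c = v).card =
      (univ.filter fun s : Fin kk → FVec p n => seedComb s c = 0).card := by
  obtain ⟨t₀, -, ht₀⟩ := hc
  set s₀ : Fin kk → FVec p n := Pi.single t₀ v
  have hs₀ : seedComb s₀ c = v := by rw [seedComb_single, ht₀, one_smul]
  have : (univ.filter fun s : Fin kk → FVec p n => seedComb s c = v) =
      (univ.filter fun s : Fin kk → FVec p n => seedComb s c = 0).map (addRightEmbedding s₀) := by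
    ext s
    simp only [mem_filter, mem_univ, true_and, mem_map, addRightEmbedding_apply]
    constructor
    · intro h
      exact ⟨s - s₀, by rw [seedComb_sub, h, hs₀, sub_self], sub_add_cancel s s₀⟩
    · rintro ⟨s', hs', rfl⟩
      rw [seedComb_add, hs', hs₀, zero_add]
  rw [this, card_map]

/-- **Uniformity of a single query**: `#{s : r_c(s) = v} = |Ω| / |V|`. [cite: AroraBarak2009, Thm. 9.12 (proof)] -/
theorem card_fibre_seedComb {c : Fin kk → ZMod p} (hc : IsRep c) (v : FVec p n) :
    ((univ.filter fun s : Fin kk → FVec p n => seedComb s c = v).card : ℝ) =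
      Fintype.card (Fin kk → FVec p n) / Fintype.card (FVec p n) := by
  have hV : (0 : ℝ) < Fintype.card (FVec p n) := Nat.cast_pos.2 Fintype.card_pos
  rw [eq_div_iff hV.ne']
  have hpart := Finset.card_eq_sum_card_fiberwise (s := (univ : Finset (Fin kk → FVec p n)))
    (t := (univ : Finset (FVec p n))) (f := fun s => seedComb s c) fun _ _ => mem_univ _
  simp_rw [card_fibre_seedComb_eq hc, Finset.sum_const, card_univ, smul_eq_mul] at hpart
  rw [card_fibre_seedComb_eq hc v, hpart]
  push_cast; ring

/-- An explicit seed tuple with prescribed values of two distinct representative queries.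
[folklore] -/
theorem exists_seedComb_pair {c c' : Fin kk → ZMod p} (hc : IsRep c) (hc' : IsRep c') (hne : c ≠ c')
    (v v' : FVec p n) : ∃ s₀ : Fin kk → FVec p n, seedComb s₀ c = v ∧ seedComb s₀ c' = v' := by
  classical
  obtain ⟨t₀, h0z, h0⟩ := hc
  obtain ⟨t₁, h1z, h1⟩ := hc'
  rcases lt_trichotomy t₀ t₁ with hlt | heq | hgt
  · -- `c' t₀ = 0`
    have hc't₀ : c' t₀ = 0 := h1z t₀ hlt
    refine ⟨Pi.single t₀ (v - c t₁ • v') + Pi.single t₁ v', ?_, ?_⟩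
    · rw [seedComb_add, seedComb_single, seedComb_single, h0, one_smul, sub_add_cancel]
    · rw [seedComb_add, seedComb_single, seedComb_single, hc't₀, zero_smul, zero_add, h1, one_smul]
  · subst heq
    obtain ⟨u, hu⟩ : ∃ u, c u ≠ c' u := Function.ne_iff.1 hne
    have hut : u ≠ t₀ := fun h => by rw [h, h0, h1] at hu; exact hu rfl
    have hd : c u - c' u ≠ 0 := sub_ne_zero.2 hu
    set b : FVec p n := (c u - c' u)⁻¹ • (v - v') with hb
    refine ⟨Pi.single t₀ (v - c u • b) + Pi.single u b, ?_, ?_⟩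
    · rw [seedComb_add, seedComb_single, seedComb_single, h0, one_smul, sub_add_cancel]
    · rw [seedComb_add, seedComb_single, seedComb_single, h1, one_smul]
      have hcalc : v - c u • b + c' u • b = v - (c u - c' u) • b := by rw [sub_smul]; abel
      have hmul : (c u - c' u) * (c u - c' u)⁻¹ = 1 := ZMod.mul_inv_of_unit _ ((isUnit_iff_ne_zero (a := c u - c' u)).2 hd)
      rw [hcalc, hb, smul_smul, hmul, one_smul, sub_sub_cancel]
  · have hct₁ : c t₁ = 0 := h0z t₁ hgt
    refine ⟨Pi.single t₁ (v' - c' t₀ • v) + Pi.single t₀ v, ?_, ?_⟩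
    · rw [seedComb_add, seedComb_single, seedComb_single, hct₁, zero_smul, zero_add, h0, one_smul]
    · rw [seedComb_add, seedComb_single, seedComb_single, h1, one_smul, sub_add_cancel]

/-- All fibres of `s ↦ (r_c(s), r_{c'}(s))` (distinct representatives) have the size of the zero
fibre. [folklore] -/
theorem card_fibre_seedComb_pair_eq {c c' : Fin kk → ZMod p} (hc : IsRep c) (hc' : IsRep c') (hne : c ≠ c')
    (v v' : FVec p n) :
    (univ.filter fun s : Fin kk → FVec p n => seedComb s c = v ∧ seedComb s c' = v').card =
      (univ.filter fun s : Fin kk → FVec p n => seedComb s c = 0 ∧ seedComb s c' = 0).card := by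
  obtain ⟨s₀, hs₀, hs₀'⟩ := exists_seedComb_pair hc hc' hne v v'
  have : (univ.filter fun s : Fin kk → FVec p n => seedComb s c = v ∧ seedComb s c' = v') =
      (univ.filter fun s : Fin kk → FVec p n => seedComb s c = 0 ∧ seedComb s c' = 0).map
        (addRightEmbedding s₀) := by
    ext s
    simp only [mem_filter, mem_univ, true_and, mem_map, addRightEmbedding_apply]
    constructor
    · rintro ⟨h, h'⟩
      exact ⟨s - s₀, ⟨by rw [seedComb_sub, h, hs₀, sub_self], by rw [seedComb_sub, h', hs₀', sub_self]⟩,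
        sub_add_cancel s s₀⟩
    · rintro ⟨s', ⟨hs', hs''⟩, rfl⟩
      exact ⟨by rw [seedComb_add, hs', hs₀, zero_add], by rw [seedComb_add, hs'', hs₀', zero_add]⟩
  rw [this, card_map]

/-- **Pairwise independence of the queries**: for distinct representatives `c, c'`,
`#{s : r_c(s) = v, r_{c'}(s) = v'} = |Ω| / |V|²`. [cite: AroraBarak2009, Thm. 9.12 (proof, "pairwise independent")] -/
theorem card_fibre_seedComb_pair {c c' : Fin kk → ZMod p} (hc : IsRep c) (hc' : IsRep c') (hne : c ≠ c')
    (v v' : FVec p n) :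
    ((univ.filter fun s : Fin kk → FVec p n => seedComb s c = v ∧ seedComb s c' = v').card : ℝ) =
      Fintype.card (Fin kk → FVec p n) / (Fintype.card (FVec p n)) ^ 2 := by
  have hV : (0 : ℝ) < Fintype.card (FVec p n) := Nat.cast_pos.2 Fintype.card_pos
  rw [eq_div_iff (by positivity)]
  have hpart := Finset.card_eq_sum_card_fiberwise (s := (univ : Finset (Fin kk → FVec p n)))
    (t := (univ : Finset (FVec p n × FVec p n))) (f := fun s => (seedComb s c, seedComb s c'))
    fun _ _ => mem_univ _
  have hfib : ∀ q : FVec p n × FVec p n,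
      (univ.filter fun s : Fin kk → FVec p n => (seedComb s c, seedComb s c') = q).card =
        (univ.filter fun s : Fin kk → FVec p n => seedComb s c = 0 ∧ seedComb s c' = 0).card := by
    rintro ⟨w, w'⟩
    rw [← card_fibre_seedComb_pair_eq hc hc' hne w w']
    congr 1; ext s; simp [Prod.ext_iff]
  simp_rw [hfib, Finset.sum_const, card_univ, smul_eq_mul, Fintype.card_prod] at hpart
  rw [card_fibre_seedComb_pair_eq hc hc' hne v v', hpart]
  push_cast; ring

end Fibres

/-! ### Counting seeds by where their queries fall -/

section Analysis

variable (kk)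

/-- The shifted query `r_c(s) + e`. [folklore] -/
def fpQuery (s : Fin kk → FVec p n) (c : Fin kk → ZMod p) (e : FVec p n) : FVec p n := seedComb s c + e

/-- Counting seeds whose shifted query lies in a set `G`: `|G| · |Ω| / |V|` (uniformity). [cite: AroraBarak2009, Thm. 9.12 (proof)] -/
theorem card_filter_fpQuery_mem {c : Fin kk → ZMod p} (hc : IsRep c) (e : FVec p n) (G : Finset (FVec p n)) :
    ((univ.filter fun s : Fin kk → FVec p n => fpQuery kk s c e ∈ G).card : ℝ) =
      G.card * (Fintype.card (Fin kk → FVec p n) / Fintype.card (FVec p n)) := by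
  have h := Finset.card_eq_sum_card_fiberwise
    (s := univ.filter fun s : Fin kk → FVec p n => fpQuery kk s c e ∈ G) (t := G)
    (f := fun s => fpQuery kk s c e) fun s hs => (mem_filter.1 hs).2
  rw [h, Nat.cast_sum]
  have : ∀ v ∈ G, (((univ.filter fun s : Fin kk → FVec p n => fpQuery kk s c e ∈ G).filter
      fun s => fpQuery kk s c e = v).card : ℝ) = Fintype.card (Fin kk → FVec p n) / Fintype.card (FVec p n) := by
    intro v hv
    rw [Finset.filter_filter, ← card_fibre_seedComb hc (v - e)]
    congr 2; ext s'
    simp only [mem_filter, mem_univ, true_and, fpQuery]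
    constructor
    · rintro ⟨-, h⟩; rw [← h, add_sub_cancel_right]
    · intro h; rw [h, sub_add_cancel]; exact ⟨hv, rfl⟩
  rw [Finset.sum_congr rfl this, Finset.sum_const, nsmul_eq_mul]

/-- Counting seeds whose shifted queries for two distinct representatives both lie in `G`:
`|G|² · |Ω| / |V|²` (pairwise independence). [cite: AroraBarak2009, Thm. 9.12 (proof)] -/
theorem card_filter_fpQuery_mem_pair {c c' : Fin kk → ZMod p} (hc : IsRep c) (hc' : IsRep c') (hne : c ≠ c')
    (e : FVec p n) (G : Finset (FVec p n)) :
    ((univ.filter fun s : Fin kk → FVec p n => fpQuery kk s c e ∈ G ∧ fpQuery kk s c' e ∈ G).card : ℝ) =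
      G.card ^ 2 * (Fintype.card (Fin kk → FVec p n) / Fintype.card (FVec p n) ^ 2) := by
  have h := Finset.card_eq_sum_card_fiberwise
    (s := univ.filter fun s : Fin kk → FVec p n => fpQuery kk s c e ∈ G ∧ fpQuery kk s c' e ∈ G) (t := G ×ˢ G)
    (f := fun s => (fpQuery kk s c e, fpQuery kk s c' e)) fun s hs => by
      have := (mem_filter.1 hs).2; exact mem_product.2 this
  rw [h, Nat.cast_sum]
  have : ∀ q ∈ G ×ˢ G, (((univ.filter fun s : Fin kk → FVec p n => fpQuery kk s c e ∈ G ∧ fpQuery kk s c' e ∈ G).filter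
      fun s => (fpQuery kk s c e, fpQuery kk s c' e) = q).card : ℝ) =
        Fintype.card (Fin kk → FVec p n) / Fintype.card (FVec p n) ^ 2 := by
    rintro ⟨v, v'⟩ hq
    obtain ⟨hv, hv'⟩ := mem_product.1 hq
    rw [Finset.filter_filter, ← card_fibre_seedComb_pair hc hc' hne (v - e) (v' - e)]
    congr 2; ext s'
    simp only [mem_filter, mem_univ, true_and, fpQuery, Prod.mk.injEq]
    constructor
    · rintro ⟨-, h, h'⟩; exact ⟨by rw [← h, add_sub_cancel_right], by rw [← h', add_sub_cancel_right]⟩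
    · rintro ⟨h, h'⟩; rw [h, h', sub_add_cancel, sub_add_cancel]; exact ⟨⟨hv, hv'⟩, rfl, rfl⟩
  rw [Finset.sum_congr rfl this, Finset.sum_const, nsmul_eq_mul, card_product, Nat.cast_mul, sq, sq]

variable (e : FVec p n) (G : Finset (FVec p n))

/-- The number of representatives whose shifted query falls in `G` (the statistic `Z`). [cite: AroraBarak2009, Thm. 9.12 (proof, `Z = Σ Z_j`)] -/
def hits (s : Fin kk → FVec p n) : ℕ := ((reps p kk).filter fun c => fpQuery kk s c e ∈ G).card

/-- `E[Z]`: `Σ_s Z(s) = m · |G| · |Ω| / |V|`. [cite: AroraBarak2009, Thm. 9.12 (proof)] -/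
theorem sum_hits :
    (∑ s : Fin kk → FVec p n, (hits kk e G s : ℝ)) =
      (reps p kk).card * (G.card * (Fintype.card (Fin kk → FVec p n) / Fintype.card (FVec p n))) := by
  unfold hits
  simp_rw [natCast_card_filter]
  rw [Finset.sum_comm]
  have h1 : ∀ c ∈ reps p kk, (∑ s : Fin kk → FVec p n, (if fpQuery kk s c e ∈ G then (1 : ℝ) else 0)) =
      G.card * (Fintype.card (Fin kk → FVec p n) / Fintype.card (FVec p n)) := fun c hc => by
    rw [← natCast_card_filter]; exact card_filter_fpQuery_mem kk (mem_reps.1 hc) e G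
  rw [Finset.sum_congr rfl h1, Finset.sum_const, nsmul_eq_mul]

/-- `E[Z²]`: `Σ_s Z(s)² = m·a + m(m-1)·b` with `a = |G||Ω|/|V|`, `b = |G|²|Ω|/|V|²`. [cite: AroraBarak2009, Thm. 9.12 (proof)] -/
theorem sum_hits_sq :
    (∑ s : Fin kk → FVec p n, (hits kk e G s : ℝ) ^ 2) =
      (reps p kk).card * (G.card * (Fintype.card (Fin kk → FVec p n) / Fintype.card (FVec p n)) +
        ((reps p kk).card - 1) * (G.card ^ 2 * (Fintype.card (Fin kk → FVec p n) / Fintype.card (FVec p n) ^ 2))) := by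
  unfold hits
  simp_rw [natCast_card_filter]
  rw [Finset.sum_congr rfl fun s _ => by rw [sq, Finset.sum_mul_sum]]
  rw [Finset.sum_comm]
  rw [← nsmul_eq_mul, ← Finset.sum_const]
  refine Finset.sum_congr rfl fun c hc => ?_
  have hcR : IsRep c := mem_reps.1 hc
  rw [Finset.sum_comm, ← Finset.add_sum_erase _ _ hc]
  congr 1
  · rw [← card_filter_fpQuery_mem kk hcR e G, natCast_card_filter]
    refine Finset.sum_congr rfl fun s _ => ?_
    split_ifs <;> simp
  · rw [Finset.sum_congr rfl fun c' hc' => by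
      have hc'R : IsRep c' := mem_reps.1 (mem_of_mem_erase hc')
      have hne : c ≠ c' := fun h => (Finset.mem_erase.1 hc').1 h.symm
      rw [show (∑ s : Fin kk → FVec p n, (if fpQuery kk s c e ∈ G then (1 : ℝ) else 0) *
          (if fpQuery kk s c' e ∈ G then (1 : ℝ) else 0)) =
          ∑ s : Fin kk → FVec p n, (if fpQuery kk s c e ∈ G ∧ fpQuery kk s c' e ∈ G then (1 : ℝ) else 0) from
            Finset.sum_congr rfl fun s _ => by rw [ite_zero_mul_ite_zero, one_mul],
        ← natCast_card_filter, card_filter_fpQuery_mem_pair kk hcR hc'R hne e G]]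
    rw [Finset.sum_const, nsmul_eq_mul, card_erase_of_mem hc, Nat.cast_sub (card_pos.2 ⟨c, hc⟩), Nat.cast_one]

/-- The sum of squared deviations of `Z` from `m q`, `q = |G|/|V|`: `|Ω| m q (1 - q)`. [cite: AroraBarak2009, Thm. 9.12 (proof) with Claim A.13] -/
theorem sum_sq_dev :
    (∑ s : Fin kk → FVec p n, ((hits kk e G s : ℝ) - (reps p kk).card * (G.card / Fintype.card (FVec p n))) ^ 2) =
      Fintype.card (Fin kk → FVec p n) * (reps p kk).card * (G.card / Fintype.card (FVec p n)) *
        (1 - G.card / Fintype.card (FVec p n)) := by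
  have hV : (0 : ℝ) < Fintype.card (FVec p n) := Nat.cast_pos.2 Fintype.card_pos
  have h1 := sum_hits kk e G
  have h2 := sum_hits_sq kk e G
  simp_rw [sub_sq]
  rw [Finset.sum_add_distrib, Finset.sum_sub_distrib, h2, Finset.sum_const, card_univ, nsmul_eq_mul]
  have h3 : (∑ s : Fin kk → FVec p n, 2 * (hits kk e G s : ℝ) * ((reps p kk).card * (G.card / Fintype.card (FVec p n)))) =
      2 * ((reps p kk).card * (G.card / Fintype.card (FVec p n))) * ∑ s : Fin kk → FVec p n, (hits kk e G s : ℝ) := by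
    rw [Finset.mul_sum]; exact Finset.sum_congr rfl fun s _ => by ring
  rw [h3, h1]
  field_simp
  ring

/-- **Chebyshev**: the seeds whose statistic deviates from its mean `m q` by at least `η m` are at
most `|Ω| / (4 η² m)`. [cite: AroraBarak2009, Thm. 9.12 (proof, Chebyshev's inequality)] -/
theorem card_dev_ge_le {η : ℝ} (hη : 0 < η) (hm : 0 < (reps p kk).card) :
    ((univ.filter fun s : Fin kk → FVec p n =>
        η * (reps p kk).card ≤ |(hits kk e G s : ℝ) - (reps p kk).card * (G.card / Fintype.card (FVec p n))|).card : ℝ) ≤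
      Fintype.card (Fin kk → FVec p n) / (4 * η ^ 2 * (reps p kk).card) := by
  have hV : (0 : ℝ) < Fintype.card (FVec p n) := Nat.cast_pos.2 Fintype.card_pos
  set m : ℝ := ((reps p kk).card : ℝ) with hmdef
  have hmpos : (0 : ℝ) < m := by rw [hmdef]; exact_mod_cast hm
  set q : ℝ := G.card / Fintype.card (FVec p n) with hq
  have hq0 : 0 ≤ q := by positivity
  have hq1 : q ≤ 1 := by
    rw [hq, div_le_one hV]; exact_mod_cast (card_le_univ G).trans_eq (by simp)
  set bad := univ.filter fun s : Fin kk → FVec p n => η * m ≤ |(hits kk e G s : ℝ) - m * q|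
  have hdev : ∀ s ∈ bad, (η * m) ^ 2 ≤ ((hits kk e G s : ℝ) - m * q) ^ 2 := by
    intro s hs
    have h := (mem_filter.1 hs).2
    have h0 : 0 ≤ η * m := by positivity
    calc (η * m) ^ 2 ≤ |(hits kk e G s : ℝ) - m * q| ^ 2 := pow_le_pow_left₀ h0 h 2
      _ = ((hits kk e G s : ℝ) - m * q) ^ 2 := sq_abs _
  have hsum : (bad.card : ℝ) * (η * m) ^ 2 ≤ Fintype.card (Fin kk → FVec p n) * m * q * (1 - q) := by
    rw [← sum_sq_dev kk e G, ← nsmul_eq_mul, ← Finset.sum_const]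
    exact (Finset.sum_le_sum hdev).trans
      (Finset.sum_le_sum_of_subset_of_nonneg (subset_univ _) fun s _ _ => sq_nonneg _)
  have hq4 : q * (1 - q) ≤ 1 / 4 := by nlinarith [sq_nonneg (q - 1 / 2)]
  have hΩ : (0 : ℝ) ≤ Fintype.card (Fin kk → FVec p n) := Nat.cast_nonneg _
  rw [le_div_iff₀ (by positivity)]
  calc (bad.card : ℝ) * (4 * η ^ 2 * m) = (bad.card * (η * m) ^ 2) * (4 / m) := by field_simp
    _ ≤ (Fintype.card (Fin kk → FVec p n) * m * q * (1 - q)) * (4 / m) := by gcongr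
    _ = Fintype.card (Fin kk → FVec p n) * (4 * (q * (1 - q))) := by field_simp
    _ ≤ Fintype.card (Fin kk → FVec p n) * 1 := by gcongr; linarith
    _ = Fintype.card (Fin kk → FVec p n) := mul_one _

end Analysis

/-! ### Noise histograms, the alignment test, and the main theorem -/

section Main

variable (kk) (B : FVec p n → ZMod p) (x : FVec p n)

/-- The points where the predictor's NOISE `B r - ⟨x, r⟩` equals `w` (`w = 0`: the agreement set). [folklore] -/
def noiseSet (w : ZMod p) : Finset (FVec p n) := univ.filter fun r => B r - x ⬝ᵥ r = w

/-- The noise sets partition the space: `Σ_w |noiseSet w| = |V|`. [folklore] -/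
theorem sum_card_noiseSet : (∑ w : ZMod p, ((noiseSet B x w).card : ℝ)) = Fintype.card (FVec p n) := by
  have h := Finset.card_eq_sum_card_fiberwise (s := (univ : Finset (FVec p n))) (t := (univ : Finset (ZMod p)))
    (f := fun r => B r - x ⬝ᵥ r) fun _ _ => mem_univ _
  rw [card_univ] at h
  rw [h, Nat.cast_sum]
  rfl

/-- The noise frequency `q_w = |noiseSet w| / |V|`. [folklore] -/
noncomputable def noiseFreq (w : ZMod p) : ℝ := (noiseSet B x w).card / Fintype.card (FVec p n)

/-- `Σ_w q_w = 1`. [folklore] -/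
theorem sum_noiseFreq : (∑ w : ZMod p, noiseFreq B x w) = 1 := by
  have hV : (0 : ℝ) < Fintype.card (FVec p n) := Nat.cast_pos.2 Fintype.card_pos
  unfold noiseFreq
  simp_rw [div_eq_mul_inv]
  rw [← Finset.sum_mul, sum_card_noiseSet, mul_inv_cancel₀ hV.ne']

/-- **The histogram of the votes for coordinate `i`** (correct guess): the number of queries `c`
with `B(r_c + eᵢ) - ⟨x, r_c⟩ = v`. [cite: CarmosinoImpagliazzoKabanetsKolokolova2016, Thm. 4.2 (GL reconstruction, "estimate `Pr[B(r, s) = ⟨c, r⟩ + σ]`")] -/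
def histI (s : Fin kk → FVec p n) (i : Fin n) (v : ZMod p) : ℕ :=
  ((reps p kk).filter fun c => B (seedComb s c + Pi.single i 1) - x ⬝ᵥ seedComb s c = v).card

/-- **The noise histogram**: the number of queries `c` with `B(r_c) - ⟨x, r_c⟩ = w`. [folklore] -/
def hist0 (s : Fin kk → FVec p n) (w : ZMod p) : ℕ :=
  ((reps p kk).filter fun c => B (seedComb s c) - x ⬝ᵥ seedComb s c = w).card

/-- The vote histogram counts hits of the shifted queries in a noise set. [folklore] -/
theorem histI_eq_hits (s : Fin kk → FVec p n) (i : Fin n) (v : ZMod p) :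
    histI kk B x s i v = hits kk (Pi.single i 1) (noiseSet B x (v - x i)) s := by
  unfold histI hits
  congr 1
  refine Finset.filter_congr fun c _ => ?_
  simp only [noiseSet, fpQuery, mem_filter, mem_univ, true_and, dotProduct_add, dotProduct_single, mul_one]
  constructor
  · intro h; rw [← h]; ring
  · intro h
    rw [show B (seedComb s c + Pi.single i 1) - x ⬝ᵥ seedComb s c =
      (B (seedComb s c + Pi.single i 1) - (x ⬝ᵥ seedComb s c + x i)) + x i by ring, h]
    ring

/-- The noise histogram counts hits of the queries in a noise set. [folklore] -/
theorem hist0_eq_hits (s : Fin kk → FVec p n) (w : ZMod p) :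
    hist0 kk B x s w = hits kk 0 (noiseSet B x w) s := by
  unfold hist0 hits
  congr 1
  refine Finset.filter_congr fun c _ => ?_
  simp [noiseSet, fpQuery]

/-- **The alignment test** of a candidate value `a` for `xᵢ` with tolerance `η`: the vote
histogram shifted by `a` matches the noise histogram up to `2 η m` everywhere. [folklore] -/
def AlignTest (η : ℝ) (s : Fin kk → FVec p n) (i : Fin n) (a : ZMod p) : Prop :=
  ∀ w : ZMod p, |(histI kk B x s i (a + w) : ℝ) - hist0 kk B x s w| ≤ 2 * η * (reps p kk).card

/-- **The candidate**: coordinate `i` is the passing value of least residue (`0` if none).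
[cite: CarmosinoImpagliazzoKabanetsKolokolova2016, Thm. 4.2 (GL reconstruction algorithm)] -/
noncomputable def glCandP (η : ℝ) (s : Fin kk → FVec p n) : FVec p n := fun i =>
  open scoped Classical in
  if h : (univ.filter fun a : ZMod p => AlignTest kk B x η s i a).Nonempty then
    Classical.choose ((univ.filter fun a : ZMod p => AlignTest kk B x η s i a).exists_min_image ZMod.val h)
  else 0

/-- **Accurate seeds**: every histogram entry is within `η m` of its mean. [folklore] -/
def Accurate (η : ℝ) (s : Fin kk → FVec p n) : Prop :=
  (∀ w : ZMod p, |(hist0 kk B x s w : ℝ) - (reps p kk).card * noiseFreq B x w| < η * (reps p kk).card) ∧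
    ∀ (i : Fin n) (v : ZMod p), |(histI kk B x s i v : ℝ) - (reps p kk).card * noiseFreq B x (v - x i)| < η * (reps p kk).card

variable {kk B x}

/-- On an accurate seed the true value passes the alignment test. [folklore] -/
theorem alignTest_true {η : ℝ} {s : Fin kk → FVec p n} (hs : Accurate kk B x η s) (i : Fin n) :
    AlignTest kk B x η s i (x i) := by
  intro w
  have h1 := hs.2 i (x i + w)
  have h2 := hs.1 w
  rw [add_sub_cancel_left] at h1
  rw [abs_sub_lt_iff] at h1 h2
  rw [abs_le]
  constructor <;> linarith

/-- **The alignment lemma**: a noise distribution with `q_0 ≥ 1/p + γ` is not `4η`-almost periodic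
for `4 (p-1) η < γ p⁻¹ · p`… precisely: if `|q_{w+δ} - q_w| < 4η` for all `w` with `δ ≠ 0`, then
`q_0 - 4 (p - 1) η < 1/p`. [folklore] -/
theorem noiseFreq_periodic_bound {η : ℝ} {δ : ZMod p} (hδ : δ ≠ 0)
    (hper : ∀ w : ZMod p, |noiseFreq B x (w + δ) - noiseFreq B x w| < 4 * η) :
    noiseFreq B x 0 - 4 * (p - 1 : ℕ) * η < 1 / p := by
  have hp1 := hp.out.one_lt
  -- along the orbit of `δ`
  have horbit : ∀ j : ℕ, noiseFreq B x 0 - 4 * j * η ≤ noiseFreq B x ((j : ZMod p) * δ) := by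
    intro j
    induction j with
    | zero => simp
    | succ j ih =>
      have h := hper ((j : ZMod p) * δ)
      rw [abs_sub_lt_iff] at h
      have : ((j + 1 : ℕ) : ZMod p) * δ = (j : ZMod p) * δ + δ := by push_cast; ring
      rw [this]; push_cast; linarith [h.2]
  -- every residue is on the orbit, at most `p - 1` steps away
  have hall : ∀ u : ZMod p, noiseFreq B x 0 - 4 * (p - 1 : ℕ) * η ≤ noiseFreq B x u := by
    intro u
    set j := (u * δ⁻¹).val with hj
    have hju : ((j : ZMod p)) * δ = u := by
      rw [hj, ZMod.natCast_zmod_val, mul_assoc, ZMod.inv_mul_of_unit _ ((isUnit_iff_ne_zero (a := δ)).2 hδ), mul_one]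
    have hjle : j ≤ p - 1 := Nat.le_sub_one_of_lt (ZMod.val_lt _)
    have hη : 0 ≤ η ∨ η < 0 := le_or_gt 0 η
    calc noiseFreq B x 0 - 4 * (p - 1 : ℕ) * η ≤ noiseFreq B x 0 - 4 * j * η := by
          rcases hη with hη | hη
          · have : (j : ℝ) ≤ (p - 1 : ℕ) := by exact_mod_cast hjle
            nlinarith
          · -- `η < 0` is impossible: `|…| < 4η` forces `0 < η`
            have := hper 0; have h0 := abs_nonneg (noiseFreq B x (0 + δ) - noiseFreq B x 0); linarith
      _ ≤ noiseFreq B x ((j : ZMod p) * δ) := horbit j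
      _ = noiseFreq B x u := by rw [hju]
  -- `η > 0` and the bound is strict at `u = 0`
  have hηpos : 0 < η := by
    have h := hper 0
    linarith [abs_nonneg (noiseFreq B x (0 + δ) - noiseFreq B x 0)]
  have hp1R : (1 : ℝ) ≤ (p - 1 : ℕ) := by exact_mod_cast Nat.le_sub_one_of_lt hp1
  have hstrict : noiseFreq B x 0 - 4 * (p - 1 : ℕ) * η < noiseFreq B x 0 := by nlinarith
  -- sum over all residues
  by_contra hge
  push Not at hge
  have hsum := sum_noiseFreq B x
  have hpR : (p : ℝ) * (1 / p) = 1 := by field_simp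
  have hlt' : (∑ _u : ZMod p, (1 : ℝ) / p) < ∑ u : ZMod p, noiseFreq B x u :=
    Finset.sum_lt_sum (fun u _ => hge.trans (hall u)) ⟨0, mem_univ _, hge.trans_lt hstrict⟩
  rw [Finset.sum_const, card_univ, ZMod.card, nsmul_eq_mul, hsum, hpR] at hlt'
  exact lt_irrefl _ hlt'

/-- **On an accurate seed only the true value passes** (`4 (p-1) η < γ`... with `q_0 ≥ 1/p + γ`):
if `a` passes the alignment test for coordinate `i`, then `a = xᵢ`. [cite: CarmosinoImpagliazzoKabanetsKolokolova2016, Thm. 4.2] -/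
theorem eq_of_alignTest {η γ : ℝ} (hγ : 4 * (p - 1 : ℕ) * η ≤ γ)
    (hB : 1 / p + γ ≤ noiseFreq B x 0) {s : Fin kk → FVec p n} (hs : Accurate kk B x η s)
    (hm : 0 < (reps p kk).card) {i : Fin n} {a : ZMod p} (ha : AlignTest kk B x η s i a) : a = x i := by
  by_contra hne
  have hδ : a - x i ≠ 0 := sub_ne_zero.2 hne
  have hmR : (0 : ℝ) < (reps p kk).card := by exact_mod_cast hm
  have hper : ∀ w : ZMod p, |noiseFreq B x (w + (a - x i)) - noiseFreq B x w| < 4 * η := by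
    intro w
    have h1 := hs.2 i (a + w)          -- `histI (a+w) ≈ m q_{a + w - x i}`
    have h2 := hs.1 w                  -- `hist0 w ≈ m q_w`
    have h3 := ha w                    -- `|histI (a+w) - hist0 w| ≤ 2 η m`
    rw [show a + w - x i = w + (a - x i) by ring] at h1
    rw [abs_sub_lt_iff] at h1 h2 ⊢
    rw [abs_le] at h3
    constructor <;> nlinarith
  have h := noiseFreq_periodic_bound (B := B) (x := x) hδ hper
  linarith

/-- **On an accurate seed the candidate is the secret.** [cite: CarmosinoImpagliazzoKabanetsKolokolova2016, Thm. 4.2] -/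
theorem glCandP_eq_of_accurate {η γ : ℝ} (hγ : 4 * (p - 1 : ℕ) * η ≤ γ) (hB : 1 / p + γ ≤ noiseFreq B x 0)
    {s : Fin kk → FVec p n} (hs : Accurate kk B x η s) (hm : 0 < (reps p kk).card) : glCandP kk B x η s = x := by
  classical
  funext i
  unfold glCandP
  have hne : (univ.filter fun a : ZMod p => AlignTest kk B x η s i a).Nonempty :=
    ⟨x i, mem_filter.2 ⟨mem_univ _, alignTest_true hs i⟩⟩
  rw [dif_pos hne]
  have hspec := Classical.choose_spec ((univ.filter fun a : ZMod p => AlignTest kk B x η s i a).exists_min_image ZMod.val hne)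
  exact eq_of_alignTest hγ hB hs hm (mem_filter.1 hspec.1).2

end Main

/-! ### The union bound and the main theorem -/

section Final

open scoped Classical

variable (kk) (B : FVec p n → ZMod p) (x : FVec p n)

/-- **Few seeds are inaccurate**: `#{s : ¬ Accurate} ≤ (n + 1) p · |Ω| / (4 η² m)` (union bound over
the `p` noise-histogram entries and the `n p` vote-histogram entries, each by Chebyshev). [cite: AroraBarak2009, Thm. 9.12 (proof, union bound)] -/
theorem card_not_accurate_le {η : ℝ} (hη : 0 < η) (hm : 0 < (reps p kk).card) :
    ((univ.filter fun s : Fin kk → FVec p n => ¬ Accurate kk B x η s).card : ℝ) ≤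
      (n + 1) * p * (Fintype.card (Fin kk → FVec p n) / (4 * η ^ 2 * (reps p kk).card)) := by
  set Ω := Fintype.card (Fin kk → FVec p n) with hΩ
  set m := (reps p kk).card with hmdef
  -- the bad events
  set bad0 : ZMod p → Finset (Fin kk → FVec p n) := fun w => univ.filter fun s =>
    η * m ≤ |(hits kk 0 (noiseSet B x w) s : ℝ) - m * ((noiseSet B x w).card / Fintype.card (FVec p n))| with hbad0
  set badI : Fin n × ZMod p → Finset (Fin kk → FVec p n) := fun iv => univ.filter fun s =>
    η * m ≤ |(hits kk (Pi.single iv.1 1) (noiseSet B x (iv.2 - x iv.1)) s : ℝ) -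
      m * ((noiseSet B x (iv.2 - x iv.1)).card / Fintype.card (FVec p n))| with hbadI
  have hsub : (univ.filter fun s : Fin kk → FVec p n => ¬ Accurate kk B x η s) ⊆
      (univ.biUnion bad0) ∪ (univ.biUnion badI) := by
    intro s hs
    have hs' := (mem_filter.1 hs).2
    rw [Accurate, not_and_or] at hs'
    rw [mem_union, mem_biUnion, mem_biUnion]
    rcases hs' with h | h
    · left
      obtain ⟨w, hw⟩ := not_forall.1 h
      refine ⟨w, mem_univ _, mem_filter.2 ⟨mem_univ _, ?_⟩⟩
      rw [← hist0_eq_hits]; rw [noiseFreq] at hw; exact not_lt.1 hw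
    · right
      obtain ⟨i, hi⟩ := not_forall.1 h
      obtain ⟨v, hv⟩ := not_forall.1 hi
      refine ⟨(i, v), mem_univ _, mem_filter.2 ⟨mem_univ _, ?_⟩⟩
      rw [← histI_eq_hits]; rw [noiseFreq] at hv; exact not_lt.1 hv
  have hb0 : ∀ w, ((bad0 w).card : ℝ) ≤ Ω / (4 * η ^ 2 * m) := fun w => card_dev_ge_le kk 0 (noiseSet B x w) hη hm
  have hbI : ∀ iv, ((badI iv).card : ℝ) ≤ Ω / (4 * η ^ 2 * m) := fun iv =>
    card_dev_ge_le kk (Pi.single iv.1 1) (noiseSet B x (iv.2 - x iv.1)) hη hm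
  calc ((univ.filter fun s : Fin kk → FVec p n => ¬ Accurate kk B x η s).card : ℝ)
      ≤ ((univ.biUnion bad0 ∪ univ.biUnion badI).card : ℝ) := by exact_mod_cast card_le_card hsub
    _ ≤ ((univ.biUnion bad0).card : ℝ) + (univ.biUnion badI).card := by exact_mod_cast card_union_le _ _
    _ ≤ (∑ w : ZMod p, ((bad0 w).card : ℝ)) + ∑ iv : Fin n × ZMod p, ((badI iv).card : ℝ) := by
        gcongr <;> exact_mod_cast card_biUnion_le
    _ ≤ (∑ _w : ZMod p, Ω / (4 * η ^ 2 * m)) + ∑ _iv : Fin n × ZMod p, Ω / (4 * η ^ 2 * m) :=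
        add_le_add (Finset.sum_le_sum fun w _ => hb0 w) (Finset.sum_le_sum fun iv _ => hbI iv)
    _ = (n + 1) * p * (Ω / (4 * η ^ 2 * m)) := by
        rw [Finset.sum_const, Finset.sum_const, card_univ, card_univ, ZMod.card, Fintype.card_prod, Fintype.card_fin,
          ZMod.card, nsmul_eq_mul, nsmul_eq_mul]
        push_cast; ring

/-- **Goldreich–Levin over `𝔽_p` (Rackoff's form with histogram alignment), success probability
`≥ 1/2`.** If `B` agrees with `r ↦ ⟨x, r⟩` on at least a `1/p + γ` fraction of `𝔽_pⁿ` and the number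
`m` of queries satisfies `(n+1) p ≤ 2 (γ/(4p))² m`, then for at least half of the seed tuples the
candidate computed with tolerance `η = γ/(4p)` from the CORRECT guess equals `x` — hence `x` is on
the list of the `p^kk` candidates of all guesses. [cite: CarmosinoImpagliazzoKabanetsKolokolova2016, Thm. 4.2] -/
theorem fp_goldreich_levin_half {γ : ℝ} (hγ : 0 < γ)
    (hB : (1 / p + γ) * Fintype.card (FVec p n) ≤ ((noiseSet B x 0).card : ℝ))
    (hm0 : 0 < (reps p kk).card)
    (hm : ((n + 1) * p : ℝ) ≤ 2 * (γ / (4 * p)) ^ 2 * (reps p kk).card) :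
    (Fintype.card (Fin kk → FVec p n) : ℝ) / 2 ≤
      ((univ.filter fun s : Fin kk → FVec p n => glCandP kk B x (γ / (4 * p)) s = x).card : ℝ) := by
  have hpR : (0 : ℝ) < p := by exact_mod_cast hp.out.pos
  have hV : (0 : ℝ) < Fintype.card (FVec p n) := Nat.cast_pos.2 Fintype.card_pos
  set η : ℝ := γ / (4 * p) with hη
  have hηpos : 0 < η := by positivity
  have hγη : 4 * (p - 1 : ℕ) * η ≤ γ := by
    rw [hη, Nat.cast_sub hp.out.pos, Nat.cast_one]
    field_simp
    nlinarith
  have hq0 : 1 / p + γ ≤ noiseFreq B x 0 := by rw [noiseFreq, le_div_iff₀ hV]; exact hB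
  -- accurate seeds are good
  have hgood : (univ.filter fun s : Fin kk → FVec p n => Accurate kk B x η s) ⊆
      (univ.filter fun s : Fin kk → FVec p n => glCandP kk B x η s = x) := by
    intro s hs
    exact mem_filter.2 ⟨mem_univ _, glCandP_eq_of_accurate hγη hq0 (mem_filter.1 hs).2 hm0⟩
  have hbad := card_not_accurate_le kk B x hηpos hm0
  have hsplit := Finset.card_filter_add_card_filter_not (s := (univ : Finset (Fin kk → FVec p n))) (Accurate kk B x η)
  rw [card_univ] at hsplit
  have hmR : (0 : ℝ) < (reps p kk).card := by exact_mod_cast hm0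
  have hfrac : (n + 1) * p * (Fintype.card (Fin kk → FVec p n) / (4 * η ^ 2 * (reps p kk).card)) ≤
      (Fintype.card (Fin kk → FVec p n) : ℝ) / 2 := by
    rw [mul_div_assoc', div_le_div_iff₀ (by positivity) (by norm_num)]
    nlinarith [hV.le, (Nat.cast_nonneg (Fintype.card (Fin kk → FVec p n)) : (0:ℝ) ≤ _)]
  have h1 : ((univ.filter fun s : Fin kk → FVec p n => Accurate kk B x η s).card : ℝ) ≥
      Fintype.card (Fin kk → FVec p n) / 2 := by
    have : ((univ.filter fun s : Fin kk → FVec p n => Accurate kk B x η s).card : ℝ) +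
        ((univ.filter fun s : Fin kk → FVec p n => ¬ Accurate kk B x η s).card : ℝ) = Fintype.card (Fin kk → FVec p n) := by
      exact_mod_cast hsplit
    linarith
  calc (Fintype.card (Fin kk → FVec p n) : ℝ) / 2 ≤ ((univ.filter fun s : Fin kk → FVec p n => Accurate kk B x η s).card : ℝ) := h1
    _ ≤ _ := by exact_mod_cast card_le_card hgood

end Final

end Literature.Computability.Cryptography
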